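import Summits.HodgeConjecture.HodgeConjecture.Theorems.WeilTypeLadder
import Summits.HodgeConjecture.HodgeConjecture.Theorems.WeilTypeLadderVariational
import Literature.AlgebraicGeometry.HodgeTheory.LefschetzOneOneHolds
import Literature.AlgebraicGeometry.Motives.AbelianVarietyProjectiveChart
import HarnessLib

/-!
# WeilTypeLadder · the Weil-degree-2 slice (`d = 2`, `m = 1`) of R3 and R3var is a THEOREM (Lefschetz (1,1))

b2b cell `hweil`, prover 2. Markman, arXiv:2509.23079 §1.1 (held text, chunk 3), verbatim: "It suffices to
prove the algebraicity of one non-zero class in `HW(A, η)`, as `K` acts via algebraic correspondences. If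
`d = 2`, then `HW(A, η)` consists of rational `(1,1)` classes, which are algebraic. Hence, we may assume that
`d > 2`." The rungs R3 (`WeilTypeLadder.WeilClassesCMField`) and R3var
(`WeilTypeLadder.WeilVariationalHodgeCMField`) quantify over every `m ≥ 1` with `d = dim_K H¹ = 2m`; their
`m = 1` slices concern rational `(1,1)`-classes and are therefore UNCONDITIONAL THEOREMS of the tree by the
rational Lefschetz `(1,1)` theorem, DISCHARGED in the tree (`lefschetzOneOne_rational_holds`,
`HodgeTheory/LefschetzOneOneHolds.lean`). This file records the two slices, so that the ladder's open
content is visibly `m ≥ 2` (`d ≥ 4`: CM field `K` of degree `e` acting on an abelian variety of dimension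
`e·m ≥ 2e`, e.g. the quartic-CM eightfolds of the companion's §12). HONEST LABEL: a case of HC that was
already a theorem (Lefschetz 1924 / Kodaira–Spencer), not a rung above the floor.

Sorry-free; no definition; no named-fact hypothesis.
-/

-- every declaration of this problem lives in `Summit.HodgeConjecture.HodgeConjecture.…` (summit = sub-problem)
set_option linter.dupNamespace false

noncomputable section

open CategoryTheory

namespace Summit.HodgeConjecture.HodgeConjecture.WeilTypeLadder

open Literature.AlgebraicGeometry Literature.AlgebraicGeometry.Motives
open Literature.AlgebraicGeometry.HodgeTheory
open Literature.AlgebraicTopology.SingularHomology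

/-- **R3 at `m = 1` (`d = 2`) holds unconditionally**: in the binders of `WeilClassesCMField` with
`m = 1`, every rational `(1,1)`-class of `weilClassesField A φ P 2` — indeed every rational `(1,1)`-class
of the abelian variety `A` — is algebraic, by the rational Lefschetz `(1,1)` theorem
(`lefschetzOneOne_rational_holds`; `A` smooth projective by `AbelianVariety.isSmoothProjective_holds`).
Markman: "If `d = 2`, then `HW(A, η)` consists of rational `(1,1)` classes, which are algebraic."
[cite: Markman2025SecantRealMultiplication, §1.1] [cite: VoisinHodgeI2002, Thm. 11.30] -/
theorem weilClassesCMField_of_m_eq_one :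
    ∀ (A : Motives.AbelianVariety ℂ) (φ : A ⟶ A) (P : Polynomial ℤ) (e : ℕ),
      P.Monic → P.natDegree = e → 2 < e → Irreducible (P.map (Int.castRingHom ℚ)) →
      Polynomial.eval₂ (Int.castRingHom (CategoryTheory.End A)) (φ : CategoryTheory.End A) P = 0 →
      e * (2 * 1) = 2 * A.dim →
      (∀ ρ : ℂ, Polynomial.eval₂ (Int.castRingHom ℂ) ρ P = 0 → starRingEnd ℂ ρ ≠ ρ) →
      (∃ Q : Polynomial ℚ, ∀ ρ : ℂ, Polynomial.eval₂ (Int.castRingHom ℂ) ρ P = 0 →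
          Polynomial.eval₂ (algebraMap ℚ ℂ) ρ Q = starRingEnd ℂ ρ) →
        ∀ c ∈ weilClassesField A φ P (2 * 1), IsRationalClass c →
          IsOfHodgeType A.dim A.X (2 * 1) 1 1 c → c ∈ algebraicClasses A.X 1 :=
  fun A _ _ _ _ _ _ _ _ _ _ _ c _ hcQ hcH ↦
    lefschetzOneOne_rational_holds (Motives.AbelianVariety.isSmoothProjective_holds (A := A)) c hcQ hcH

/-- **R3var at `m = 1` (`d = 2`) holds unconditionally**: in the binders of `WeilVariationalHodgeCMField`
with `m = 1`, the fibre restriction `W|_{𝒳_s}` is a rational `(1,1)`-class on the smooth projective fibre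
`𝒳_s` (`IsSmoothProjectiveFamily.isSmoothProjective`), hence algebraic by the rational Lefschetz `(1,1)`
theorem — on EVERY fibre, anchor or not. [cite: Markman2025SecantRealMultiplication, §1.1]
[cite: VoisinHodgeI2002, Thm. 11.30] -/
theorem weilVariationalHodgeCMField_of_m_eq_one :
    ∀ (P : Polynomial ℤ) (e : ℕ), P.Monic → P.natDegree = e → Irreducible (P.map (Int.castRingHom ℚ)) →
      (∀ ρ : ℂ, Polynomial.eval₂ (Int.castRingHom ℂ) ρ P = 0 → starRingEnd ℂ ρ ≠ ρ) →
      (∃ Q : Polynomial ℚ, ∀ ρ : ℂ, Polynomial.eval₂ (Int.castRingHom ℂ) ρ P = 0 →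
          Polynomial.eval₂ (algebraMap ℚ ℂ) ρ Q = starRingEnd ℂ ρ) →
      ∀ ⦃𝒳 S : Motives.SchemeOver ℂ⦄ (f : 𝒳 ⟶ S), Motives.IsSmoothProjectiveFamily f (e * 1) →
        IsQuasiProjectiveOver 𝒳 → IsQuasiProjectiveOver S → IrreducibleSpace S.left →
        AlgebraicGeometry.Smooth S.hom →
        ∀ (W : complexBetti 𝒳 (2 * 1)),
          (∀ s : Motives.ComplexPoints S,
            IsRationalClass (complexBetti.map (Motives.fiberι f s) (2 * 1) W) ∧
              IsOfHodgeType (e * 1) (Motives.fiberOver f s) (2 * 1) 1 1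
                (complexBetti.map (Motives.fiberι f s) (2 * 1) W)) →
          (∀ s : Motives.ComplexPoints S, ∃ (A' : Motives.AbelianVariety ℂ) (φ' : A' ⟶ A')
              (e' : A'.X ≅ Motives.fiberOver f s),
            Polynomial.eval₂ (Int.castRingHom (CategoryTheory.End A')) (φ' : CategoryTheory.End A') P = 0 ∧
              e * (2 * 1) = 2 * A'.dim ∧
              complexBetti.map e'.hom (2 * 1) (complexBetti.map (Motives.fiberι f s) (2 * 1) W) ∈
                weilClassesField A' φ' P (2 * 1)) →
          (∃ s₀ : Motives.ComplexPoints S,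
            complexBetti.map (Motives.fiberι f s₀) (2 * 1) W ∈
              algebraicClasses (Motives.fiberOver f s₀) 1) →
          ∀ s : Motives.ComplexPoints S,
            complexBetti.map (Motives.fiberι f s) (2 * 1) W ∈ algebraicClasses (Motives.fiberOver f s) 1 :=
  fun _ _ _ _ _ _ _ _ _ _ hf _ _ _ _ _ hW _ _ s ↦
    lefschetzOneOne_rational_holds (hf.isSmoothProjective s) _ (hW s).1 (hW s).2

end Summit.HodgeConjecture.HodgeConjecture.WeilTypeLadder

end
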